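import Summits.QuantumFields.BalabanUV.T4Continuum.Support.NE9KerChartCauchyPointwise
import Summits.QuantumFields.BalabanUV.T4Continuum.Support.NE9CurChartTower
import Literature.MathematicalPhysics.QuantumFieldTheory.Balaban1983to89.B9Eq319QprimeTowerCentre

/-!
# NE9KerChartCauchyTower — THE DECAY-FREE CAUCHY CORE OF THE KERNEL SPECIES `ker U` AT THE `cur U` CHART OF PRINT'S `k`-TH-STEP OPERATOR:
# (F) `Support/NE9KerChartCauchyCore` + the SEQUEL `Support/NE9KerChartCauchyPointwise` ONE STOREY UP, re-instantiated at the letters of the row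
# owner's `Support/NE9CurChartTower.cur_chart_exists_tower_of_small_bonds_unitary` (gen 83, INTERFACE REQUEST NE9 #4); cell `pub-balaban`, T4-DAG §2
# node U3 ∕ §6 NE9, WALL-NE9-P1 §3 (ii)∕(vii) (MODEL item O-NE9-1 (ii) «the kernel species `ker`»), the owner's `TOWER-SPECIES-PLAN.md` §2 (d) «k-LEVEL
# `ker` Cauchy core = g82's (F) re-instantiated at `cur_chart_exists_tower_of_small_bonds_unitary`'s (Ψ1)(Ψ2) (S-sized; owner or leaf-01)»; BINDER row
# NE9 (owner lineage `b2b-balaban-t4-ne9-p1`); Summits-side NEW leaf by NE9 leaf-01 (`b2b-balaban-t4-ne9-formalise-leaf-01`, gen 78) under the owner's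
# INTERFACE REQUEST NE9 #2 (extended by name, journal W-ne9p1-g82-3) one storey up (ruling e34b3e0c (0)); nothing printed asserted

HONEST FRAMING (T4-DAG PAGE 1).  Rung (B)+1 of the FINITE-VOLUME T⁴ programme — NOT infinite volume, NOT a mass gap, NOT the Clay problem.  NE9
(`T4OutputRate.NE9` ∧ `FadingMemory`) is a cell NEW ESTIMATE, NOT PRINTED in [I] = [Balaban1987RG1] (CMP **109**) ∕ [II] = [Balaban1988RG2Cluster]
(CMP **116**), NOT PROVED here («NE9 ⇐ the named binders»; spine PROVED 0∕9).  HONEST DEPENDENCY (cell line, verbatim): continuum YM on T⁴ ⇐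
BetaPertH ∧ nine spine estimates (0/9 proved); BetaPertH ⇐ (D1) ∧ (D4) ∧ CAP+tail; G-an2-4 gates asym, D1 and NE2/3/4.  The kernel species `ker`
is ONE field of the MODEL O-NE9-1 (ii) (`NE9Lemma1KernelSpecies.KerData.ker`); its binder (K) `kerBound` = DECAY × ANALYTICITY ([I] (4.5) p. 282,
(4.22) p. 286).  THIS FILE IS THE ANALYTICITY FACTOR at the chart of `cur U` for the `k`-LEVEL operator `Δ_a^{(k)}(U)` of
[Balaban1985BackgroundPropagators] (3.26) (composite averagings `Q_k(U)`, `Q′_k(U)` of (3.15)∕(3.19)); the decay factor ([Balaban1985Variational]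
(189)–(190), the lattice-uniformity T-row) is NOT here; the END's `act` half and NEEDS-COORDINATOR #5 are untouched; `ker` is NOT constructed.

WHY THIS FILE.  (F) and its SEQUEL live at the ONE-STEP letters (`laplaceAofBackground`, `QtorusW`, `Cc`; the declared reading (M3) «one averaging
level only»); print's `j`-th step differentiates the old terms composed with the chart of the `k`-LEVEL background map ([I] (4.2)–(4.5)).  The
owner's `Support/NE9CurChartTower` (gen 83) typed that chart (`laplaceAk`, `QkW`, `Cck`) with (Ψ1)–(Ψ3) at every unitary small-bond background;
this file attaches the Cauchy core to it — `TOWER-SPECIES-PLAN.md` §2 (d).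

WHAT THIS FILE PROVES (THREE theorems; 0 def, 0 sorry, axioms standard; [folklore] composition BY NAME — no inequality of the series asserted as printed).
* §1 **`kerCauchy_of_chart`** — ABSTRACT CHART `Φ : NegSize L η lev 0 𝔸 → G` with (Ψ1) `DifferentiableOn ℂ Φ (ball 0 R_b)` and (Ψ2)
  `MapsTo Φ (ball 0 R_b) (ball 0 R_X)`, old term `F` holomorphic on `ball 0 R_X` with `‖F‖ ≤ M`, `0 < r < R_b`: the THREE decay-free rows in one
  conjunction — (i) `‖Dᴺ(F ∘ Φ)(0)‖ ≤ M·(N∕r)ᴺ` ((E) `B12Eq422KernelCauchy.norm_iteratedFDeriv_comp_le_of_ball`), (ii) the every-index-tuple kernel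
  bound `‖𝐄⁽ᴺ⁾(xs)[b]‖ ≤ M·(N∕r)ᴺ·∏‖b_k‖` (SEQUEL `norm_kernelE_chart_apply_le`), (iii) the VOLUME-FREE bilocalized `(p, q)` bound
  `‖Σ_{x₁,x₂}𝐄⁽⁴⁾(p,x₁,x₂,q)[δB(p),B(x₁),B(x₂),B′(q)]‖ ≤ M·(4∕r)⁴·‖δB(p)‖·‖B‖²_sup·‖B′(q)‖` (SEQUEL `norm_sum_sum_kernelE_four_chart_le`; print's
  p. 286 currency) — so that ANY exported (Ψ1)(Ψ2) (one step, `k` levels, one instance, uniform ball) yields the kernel species' K-core in ONE call.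
* §2 **`kerCauchy_tower_of_small_bonds_unitary`** — THE INSTANCE AT THE `k`-LEVEL LETTERS of `NE9CurChartTower.cur_chart_exists_tower_of_small_bonds_unitary`
  (its binders VERBATIM: `2 ≤ L`, the norming data `φ, τ` with `⟨φ⁻¹X, φ⁻¹Y⟩ = τ(X*Y)`, `τ` tracial, `η ≠ 0`, the averaging-closed gauge group `G`
  with [Balaban1985Averaging] Prop. 2's numerics `α₀` (`C₀α₀ ≤ 1∕3`, `4α₀ ≤ c₂′`, `50(d+1)·αT·L^d ≤ 1∕2`) and `Cck`'s radius `ρ`, `n+1 ≤ lev₀`, `a > 0`,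
  the bound `CS` of the right inverses): `∃ ε₁ > 0 ∀ U` with `Ũ ∈ G`, right inverses `S₁`∕`S₂` of `Q′_k(1)`∕`Q′_k(U)` bounded by `CS`, `U(b) ∈ U1`,
  `‖U(b) − 1‖ ≤ ε ≤ ε₁`, `U(b)* = U(b)⁻¹`, `∀` (L3) slot `W` (`QuadAnalytic W C₄ a₃`, analytic): `∃ h52 ∃ hpos ∃ ε₄ ε_C R_b R′`, `0 < R_b`, `0 < R′`,
  the host's (Ψ1) ∧ (Ψ2) ∧ (Ψ3) KEPT AS CONJUNCTS, AND for every old term `F : Space115(∇_U) → X` (`X` complete) holomorphic on `ball 0 R′` with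
  `‖F‖ ≤ M` and every `0 < r < R_b`: rows (i)(ii)(iii) of §1 at the chart
  `chartHB 𝔊_k(U) 0 W 0 (A′ ↦ A′ + solA H_{1,k}(U) 0 C_k(U) 0 ε_C A′) ε₄ H_{1,k}(U)` read on `Bond → 𝔸` through the weight-one identification.
  The radii come AFTER `∀ U` here (per background, as in the host's §4; the `k`-level UNIFORM ball is `TOWER-SPECIES-PLAN.md` §2 (b), not built):
  `M(N∕r)ᴺ` is a number PER BACKGROUND at `k` levels — unlike the one-step SEQUEL, whose radii precede `∀ U`.
* §3 **`kerCauchy_tower_of_small_bonds_unitary'`** — §2 WITH THE SECTIONS DISCHARGED: NE9 leaf-02's universal right inverse of `Q′_k`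
  (`B9Eq319QprimeTowerCentre.exists_QprimeTowerW_rightInverse`, gen 62: ONE linear `S` with `Q′_k(U) ∘ S = id` for every `φ`, `U`, bounded by
  `(L^d)^{n+1}√(c₀·#T_m)` from the sup norm) inhabits `S₁ = S₂ = S` with `CS := (L^d)^{n+1}√(c₀·#T_m)` fixed BEFORE `∃ ε₁`; background binders left:
  `Ũ ∈ G`, `U(b) ∈ U1`, `‖U(b) − 1‖ ≤ ε ≤ ε₁`, `U(b)* = U(b)⁻¹` — and the (L3) slot `W`.  (The host's own sections-free corollary
  `cur_chart_exists_tower_of_small_bonds_unitary'` is the OWNER's ∕ leaf-02's to append, `TOWER-SPECIES-PLAN.md` §2 (a); §3 goes through §2 and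
  leaf-02's theorem BY NAME and restates neither.)
DISGUISE TEST: composition of landed theorems at a FIXED lattice and FIXED `k`; constants per lattice and per `k` — NOT print's uniformity in the
LATTICE ([Balaban1985BackgroundPropagators] Thms 3.12∕3.13), NOT the decay of (4.5)∕(4.22), NOT the field sizes (4.17)–(4.18), NOT the (4.6)
insertion frame, NOT `ker`'s definition, NOT (K)∕(4.22) as printed, NOT claimed that Bałaban's `𝐇_k` ∕ `U_j(□₀, exp iB)` meet these letters
(O-NE9-1; #5 UNRULED); not NE9.  Loci (TYPES only): [Balaban1987RG1] (4.2)–(4.5) pp. 281–282, (4.19)–(4.22) pp. 285–286;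
[Balaban1985BackgroundPropagators] (3.15)∕(3.19) p. 393, (3.26) p. 395; [Balaban1985Variational] (174) p. 305.
Imports the SEQUEL `Support/NE9KerChartCauchyPointwise` (it carries (F), (E)), the host `Support/NE9CurChartTower` and leaf-02's `B9Eq319QprimeTowerCentre`
(which imports `B9Eq326OperatorTower` only — inside the host's cone); modifies nothing; no END re-wired.
Value = `TOWER-SPECIES-PLAN.md` §2 (d) discharged: the analyticity half of (K) `kerBound` is a KERNEL statement at the `k`-level chart for every
admissible old term; NOT summit progress.
-/

noncomputable section

open Metric Set Finset
open scoped BigOperators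

namespace Summit.QuantumFields.BalabanUV.T4Continuum.NE9KerChartCauchyTower

open Literature.MathematicalPhysics.QuantumFieldTheory.Balaban1983to89
open B11Eq115Space B12Eq419Kernel B12Eq422KernelCauchy
open Summit.QuantumFields.BalabanUV.T4Continuum.NE9KerChartCauchyPointwise (norm_kernelE_chart_apply_le norm_sum_sum_kernelE_four_chart_le)

/-! ## §1 The three decay-free rows at an abstract chart on the `NegSize … 0` carrier, in one conjunction -/

section Chart

variable {ι : Type*} [Fintype ι] [DecidableEq ι] {𝔸 : Type*} [NormedAddCommGroup 𝔸] [NormedSpace ℂ 𝔸]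
  {G : Type*} [NormedAddCommGroup G] [NormedSpace ℂ G] {X : Type*} [NormedAddCommGroup X] [NormedSpace ℂ X] [CompleteSpace X]
  {L η : ℝ} [Fact (0 < L)] [Fact (0 < η)] {lev : ι → ℕ}

/-- **THE K-CORE OF THE KERNEL SPECIES AT AN ABSTRACT CHART, decay-free, in one call**: for `Φ` Fréchet-differentiable on
`ball 0 R_b ⊆ NegSize L η lev 0 𝔸` mapping it into `ball 0 R_X`, `F` holomorphic on `ball 0 R_X` with `‖F‖ ≤ M` there and `0 < r < R_b`:
(i) `‖Dᴺ(F ∘ Φ)(0)‖ ≤ M·(N∕r)ᴺ`; (ii) `‖kernelE N (F ∘ Φ ∘ e.symm) 0 xs b‖ ≤ M·(N∕r)ᴺ·∏‖b_k‖` at EVERY index tuple; (iii) the bilocalized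
`(p, q)` term of [Balaban1987RG1] (4.21) in print's p. 286 currency `M·(4∕r)⁴·‖δB(p)‖·‖B‖²·‖B′(q)‖` — (E) + the SEQUEL's §2 by name. [folklore] -/
theorem kerCauchy_of_chart {Φ : NegSize L η lev 0 𝔸 → G} {F' : G → X} {Rb RX M : ℝ}
    (hΨ1 : DifferentiableOn ℂ Φ (ball (0 : NegSize L η lev 0 𝔸) Rb))
    (hΨ2 : MapsTo Φ (ball (0 : NegSize L η lev 0 𝔸) Rb) (ball (0 : G) RX))
    (hF : DifferentiableOn ℂ F' (ball 0 RX)) (hM : ∀ y ∈ ball (0 : G) RX, ‖F' y‖ ≤ M) {r : ℝ} (hr : 0 < r) (hrR : r < Rb) :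
    (∀ N : ℕ, ‖iteratedFDeriv ℂ N (F' ∘ Φ) 0‖ ≤ M * ((N : ℝ) / r) ^ N) ∧
    (∀ (N : ℕ) (xs : Fin N → ι) (b : Fin N → 𝔸),
      ‖kernelE (𝕜 := ℂ) N (F' ∘ Φ ∘ (NegSup.continuousLinearEquiv ℂ (levWeight L η lev 0) (V := 𝔸)).symm) 0 xs b‖ ≤
        M * ((N : ℝ) / r) ^ N * ∏ k, ‖b k‖) ∧
    (∀ (δB B B' : ι → 𝔸) (p q : ι),
      ‖∑ x₁, ∑ x₂, kernelE (𝕜 := ℂ) 4 (F' ∘ Φ ∘ (NegSup.continuousLinearEquiv ℂ (levWeight L η lev 0) (V := 𝔸)).symm) 0 ![p, x₁, x₂, q]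
          ![δB p, B x₁, B x₂, B' q]‖ ≤ M * ((4 : ℝ) / r) ^ 4 * (‖δB p‖ * ‖B‖ ^ 2 * ‖B' q‖)) :=
  ⟨fun N => norm_iteratedFDeriv_comp_le_of_ball hΨ1 hΨ2 hF hM hr hrR N,
    fun N xs b => norm_kernelE_chart_apply_le (L := L) (η := η) (lev := lev) hΨ1 hΨ2 hF hM hr hrR N xs b,
    fun δB B B' p q => norm_sum_sum_kernelE_four_chart_le (L := L) (η := η) (lev := lev) hΨ1 hΨ2 hF hM hr hrR δB B B' p q⟩

end Chart

/-! ## §2 The instance at the `k`-level letters of `NE9CurChartTower.cur_chart_exists_tower_of_small_bonds_unitary` -/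

section Tower

open B11Eq103H1Complex B11Eq174Chart
open B11Eq111FrakG (nabla115)
open B13Contraction113 (QuadAnalytic)
open B9SectCLatticeCarrier (Bond)
open B4Sect5Torus (TSite)
open B7Prop1Explicit (U1)
open B7Prop2Explicit (pdev AvgClosed C0 c2')
open B7Prop3Flat (c3)
open B9Eq315QTorus (perCfg)
open B9Eq315QTower (towerP)
open B9Eq326OperatorTower (QprimeTowerW QkW_surjective laplaceAk)
open B11Eq44COperatorTower (αT αT_le ulev_mem_U1_of_pdev ulev_reg_of_pdev)
open B11Eq44CLetterTower (Cck)
open Summit.QuantumFields.BalabanUV.T4Continuum.NE9CurChartTower (cur_chart_exists_tower_of_small_bonds_unitary)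

/-- **THE DECAY-FREE CAUCHY CORE OF `ker U` AT THE `cur U` CHART FOR PRINT'S `k`-TH-STEP OPERATOR, AT EVERY UNITARY SMALL-BOND BACKGROUND OF A
FIXED LATTICE** — see the module header: the host's `∃ ε₁ > 0 ∀ U … ∃ h52 ∃ hpos ∃ ε₄ ε_C R_b R′` with (Ψ1) ∧ (Ψ2) ∧ (Ψ3) KEPT, AND for every old
term `F` holomorphic on `ball 0 R′` with `‖F‖ ≤ M`, every `0 < r < R_b`: `‖Dᴺ(F ∘ chart_U)(0)‖ ≤ M(N∕r)ᴺ`, the every-index-tuple kernel bound and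
the volume-free `(p, q)` bound ([Balaban1987RG1] (4.2)–(4.5), (4.19)–(4.22) at the `k`-level chart; binders those of
`cur_chart_exists_tower_of_small_bonds_unitary`, verbatim). [folklore] -/
theorem kerCauchy_tower_of_small_bonds_unitary {d : ℕ} (L : ℕ) [NeZero L] (m : Fin d → ℕ) [∀ i, NeZero (m i)] (n : ℕ) (hL : 1 ≤ L)
    (hL2 : 2 ≤ L)
    {𝔸 : Type*} [NormedRing 𝔸] [NormedAlgebra ℂ 𝔸] [CompleteSpace 𝔸] [NormOneClass 𝔸] [StarRing 𝔸] [NormedStarGroup 𝔸] [StarModule ℂ 𝔸]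
    [FiniteDimensional ℂ 𝔸]
    {W : Type*} [NormedAddCommGroup W] [InnerProductSpace ℂ W] [FiniteDimensional ℂ W] (φ : W ≃ₗ[ℂ] 𝔸) {Mφ Mφ' : ℝ} (hMφ : 0 ≤ Mφ)
    (hMφ' : 0 ≤ Mφ') (hφ : ∀ w, ‖φ w‖ ≤ Mφ * ‖w‖) (hφ' : ∀ X, ‖φ.symm X‖ ≤ Mφ' * ‖X‖)
    (τ : 𝔸 →ₗ[ℂ] ℂ) {Cτ : ℝ} (hτ : ∀ X, ‖τ X‖ ≤ Cτ * ‖X‖) (hCτ : 0 ≤ Cτ)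
    (hτφ : ∀ X Y : 𝔸, inner ℂ (φ.symm X) (φ.symm Y) = τ (star X * Y)) (htr : ∀ X Y : 𝔸, τ (X * Y) = τ (Y * X))
    {η : ℝ} (hη : η ≠ 0) [Fact (0 < (L : ℝ))] [Fact (0 < η)] {lev₀ : Bond d (towerP L m (n + 1)) → ℕ} {levB : Bond d m → ℕ}
    (lev₁ : Bond d (towerP L m (n + 1)) × Fin d → ℕ)
    {G : Subgroup 𝔸ˣ} (hG : AvgClosed d L G) {α₀ : ℝ} (hα₀ : 0 < α₀) (hα3 : C0 d * α₀ ≤ 1 / 3) (hα4 : 4 * α₀ ≤ c2' d L)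
    (hαL : 50 * (d + 1) * αT d L α₀ * (L : ℝ) ^ d ≤ 1 / 2) (hlev : ∀ b, n + 1 ≤ lev₀ b)
    {ρ : ℝ} (hρ0 : 0 < ρ) (hρ : Real.exp (4 * (800 * ((d : ℝ) + 1) ^ 2 * ((d : ℝ) + 4)) * α₀) * (1 + 8 * (131072 * ((d : ℝ) + 1) ^ 2) * ρ) ≤ 2)
    (hρc : 2 * ρ ≤ c3 d L) {c₀ c₁ : ℝ} [Fact (0 < c₀)] [Fact (0 < c₁)] {a : ℝ} (ha : 0 < a) {CS : ℝ} (hCS : 0 ≤ CS)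
    {X : Type*} [NormedAddCommGroup X] [NormedSpace ℂ X] [CompleteSpace X] :
    ∃ ε₁ : ℝ, 0 < ε₁ ∧ ∀ (U : Bond d (towerP L m (n + 1)) → 𝔸ˣ)
      (hUG : ∀ (x : B7Prop1Explicit.Site d) (κ : Fin d), perCfg (towerP L m (n + 1)) U x κ ∈ G)
      (S₁ S₂ : (TSite d m → W) →ₗ[ℂ] SiteL2K ℂ d (towerP L m (n + 1)) c₀ W)
      {ε : ℝ}, 0 ≤ ε → ε ≤ ε₁ →
      (∀ b, U b ∈ U1 𝔸) → (∀ b, ‖(U b : 𝔸) - 1‖ ≤ ε) → (∀ b, star (U b : 𝔸) = (((U b)⁻¹ : 𝔸ˣ) : 𝔸)) →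
      (∀ f, QprimeTowerW L m n φ (fun _ : Bond d (towerP L m (n + 1)) => (1 : 𝔸ˣ)) (S₁ f) = f) →
      (∀ f, QprimeTowerW L m n φ U (S₂ f) = f) → (∀ f, ‖S₁ f‖ ≤ CS * ‖f‖) → (∀ f, ‖S₂ f‖ ≤ CS * ‖f‖) →
      ∀ {Wq : Space115 (L : ℝ) η lev₀ lev₁ (nabla115 η U) → NegSize (L : ℝ) η lev₀ 3 𝔸} {C₄ a₃ : ℝ}, QuadAnalytic Wq C₄ a₃ → 0 ≤ C₄ → 0 < a₃ →
        AnalyticOnNhd ℂ Wq {Y | ‖Y‖ < a₃} →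
      ∃ h52 : pdev (perCfg (towerP L m (n + 1)) U) < α₀ * (((L : ℝ) ^ (n + 1))⁻¹) ^ 2,
      ∃ hpos : ∀ x : BondL2K ℂ d (towerP L m (n + 1)) c₀ W, x ≠ 0 →
          0 < RCLike.re (inner ℂ x (laplaceAk L m n φ η U hL (fun _ => αT d L α₀) (fun _ => αT_le hL hα4)
            (ulev_mem_U1_of_pdev L m (n + 1) U hL2 hG hUG hα₀ hα3 hα4 h52) (ulev_reg_of_pdev L m (n + 1) U hL2 hG hUG hα₀ hα3 hα4 h52) τ
            (c₀ := c₀) (c₁ := c₁) a x)),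
      ∃ ε₄ εC Rb R' : ℝ, 0 < Rb ∧ 0 < R' ∧
        DifferentiableOn ℂ (chartHB (frakGLatticeCLM (lev₀ := lev₀) φ hpos (QkW_surjective L m n φ U hL _ _ _ _ fun _ => hαL) lev₁ (nabla115 η U))
            0 Wq 0 (fun A' => A' + solA (H1LatticeCLM (lev₀ := lev₀) (levB := levB) φ hpos (QkW_surjective L m n φ U hL _ _ _ _ fun _ => hαL) lev₁
              (nabla115 η U)) 0 (Cck L m η (n + 1) U lev₀ lev₁ (nabla115 η U) levB) 0 εC A') ε₄
            (H1LatticeCLM (lev₀ := lev₀) (levB := levB) φ hpos (QkW_surjective L m n φ U hL _ _ _ _ fun _ => hαL) lev₁ (nabla115 η U)))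
          (ball (0 : NegSize (L : ℝ) η levB 0 𝔸) Rb) ∧
        MapsTo (chartHB (frakGLatticeCLM (lev₀ := lev₀) φ hpos (QkW_surjective L m n φ U hL _ _ _ _ fun _ => hαL) lev₁ (nabla115 η U))
            0 Wq 0 (fun A' => A' + solA (H1LatticeCLM (lev₀ := lev₀) (levB := levB) φ hpos (QkW_surjective L m n φ U hL _ _ _ _ fun _ => hαL) lev₁
              (nabla115 η U)) 0 (Cck L m η (n + 1) U lev₀ lev₁ (nabla115 η U) levB) 0 εC A') ε₄
            (H1LatticeCLM (lev₀ := lev₀) (levB := levB) φ hpos (QkW_surjective L m n φ U hL _ _ _ _ fun _ => hαL) lev₁ (nabla115 η U)))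
          (ball (0 : NegSize (L : ℝ) η levB 0 𝔸) Rb) (ball (0 : Space115 (L : ℝ) η lev₀ lev₁ (nabla115 η U)) R') ∧
        chartHB (frakGLatticeCLM (lev₀ := lev₀) φ hpos (QkW_surjective L m n φ U hL _ _ _ _ fun _ => hαL) lev₁ (nabla115 η U))
            0 Wq 0 (fun A' => A' + solA (H1LatticeCLM (lev₀ := lev₀) (levB := levB) φ hpos (QkW_surjective L m n φ U hL _ _ _ _ fun _ => hαL) lev₁
              (nabla115 η U)) 0 (Cck L m η (n + 1) U lev₀ lev₁ (nabla115 η U) levB) 0 εC A') ε₄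
            (H1LatticeCLM (lev₀ := lev₀) (levB := levB) φ hpos (QkW_surjective L m n φ U hL _ _ _ _ fun _ => hαL) lev₁ (nabla115 η U)) 0 = 0 ∧
        ∀ (F' : Space115 (L : ℝ) η lev₀ lev₁ (nabla115 η U) → X) (M : ℝ),
          DifferentiableOn ℂ F' (ball (0 : Space115 (L : ℝ) η lev₀ lev₁ (nabla115 η U)) R') →
          (∀ y ∈ ball (0 : Space115 (L : ℝ) η lev₀ lev₁ (nabla115 η U)) R', ‖F' y‖ ≤ M) →
          ∀ {r : ℝ}, 0 < r → r < Rb →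
        (∀ N : ℕ, ‖iteratedFDeriv ℂ N (F' ∘ chartHB (frakGLatticeCLM (lev₀ := lev₀) φ hpos (QkW_surjective L m n φ U hL _ _ _ _ fun _ => hαL) lev₁
              (nabla115 η U))
            0 Wq 0 (fun A' => A' + solA (H1LatticeCLM (lev₀ := lev₀) (levB := levB) φ hpos (QkW_surjective L m n φ U hL _ _ _ _ fun _ => hαL) lev₁
              (nabla115 η U)) 0 (Cck L m η (n + 1) U lev₀ lev₁ (nabla115 η U) levB) 0 εC A') ε₄
            (H1LatticeCLM (lev₀ := lev₀) (levB := levB) φ hpos (QkW_surjective L m n φ U hL _ _ _ _ fun _ => hαL) lev₁ (nabla115 η U))) 0‖ ≤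
            M * ((N : ℝ) / r) ^ N) ∧
        (∀ (N : ℕ) (xs : Fin N → Bond d m) (b : Fin N → 𝔸),
          ‖kernelE (𝕜 := ℂ) N (F' ∘ chartHB (frakGLatticeCLM (lev₀ := lev₀) φ hpos (QkW_surjective L m n φ U hL _ _ _ _ fun _ => hαL) lev₁
              (nabla115 η U))
            0 Wq 0 (fun A' => A' + solA (H1LatticeCLM (lev₀ := lev₀) (levB := levB) φ hpos (QkW_surjective L m n φ U hL _ _ _ _ fun _ => hαL) lev₁
              (nabla115 η U)) 0 (Cck L m η (n + 1) U lev₀ lev₁ (nabla115 η U) levB) 0 εC A') ε₄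
            (H1LatticeCLM (lev₀ := lev₀) (levB := levB) φ hpos (QkW_surjective L m n φ U hL _ _ _ _ fun _ => hαL) lev₁ (nabla115 η U)) ∘
            (NegSup.continuousLinearEquiv ℂ (levWeight (L : ℝ) η levB 0) (V := 𝔸)).symm) 0 xs b‖ ≤
            M * ((N : ℝ) / r) ^ N * ∏ k, ‖b k‖) ∧
        (∀ (δB B B' : Bond d m → 𝔸) (p q : Bond d m),
          ‖∑ x₁, ∑ x₂, kernelE (𝕜 := ℂ) 4 (F' ∘ chartHB (frakGLatticeCLM (lev₀ := lev₀) φ hpos (QkW_surjective L m n φ U hL _ _ _ _ fun _ => hαL)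
              lev₁ (nabla115 η U))
            0 Wq 0 (fun A' => A' + solA (H1LatticeCLM (lev₀ := lev₀) (levB := levB) φ hpos (QkW_surjective L m n φ U hL _ _ _ _ fun _ => hαL) lev₁
              (nabla115 η U)) 0 (Cck L m η (n + 1) U lev₀ lev₁ (nabla115 η U) levB) 0 εC A') ε₄
            (H1LatticeCLM (lev₀ := lev₀) (levB := levB) φ hpos (QkW_surjective L m n φ U hL _ _ _ _ fun _ => hαL) lev₁ (nabla115 η U)) ∘
            (NegSup.continuousLinearEquiv ℂ (levWeight (L : ℝ) η levB 0) (V := 𝔸)).symm) 0 ![p, x₁, x₂, q]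
              ![δB p, B x₁, B x₂, B' q]‖ ≤
            M * ((4 : ℝ) / r) ^ 4 * (‖δB p‖ * ‖B‖ ^ 2 * ‖B' q‖)) := by
  obtain ⟨ε₁, hε₁, H⟩ := cur_chart_exists_tower_of_small_bonds_unitary L m n hL hL2 φ (c₀ := c₀) (c₁ := c₁) (lev₀ := lev₀) (levB := levB)
    hMφ hMφ' hφ hφ' τ hτ hCτ hτφ htr hη lev₁ hG hα₀ hα3 hα4 hαL hlev hρ0 hρ hρc ha hCS
  refine ⟨ε₁, hε₁, ?_⟩
  intro U hUG S₁ S₂ ε hε hεle hUb hUε hUstar hS₁ hS₂ hS₁n hS₂n Wq C₄ a₃ hW hC₄ ha₃ hWa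
  obtain ⟨h52, hpos, ε₄, εC, Rb, R', hRb0, hR'0, hΨ1, hΨ2, hΨ3⟩ :=
    H U hUG S₁ S₂ hε hεle hUb hUε hUstar hS₁ hS₂ hS₁n hS₂n hW hC₄ ha₃ hWa
  refine ⟨h52, hpos, ε₄, εC, Rb, R', hRb0, hR'0, hΨ1, hΨ2, hΨ3, fun F' M hF hM r hr hrR => ?_⟩
  exact kerCauchy_of_chart (L := (L : ℝ)) (η := η) (lev := levB) hΨ1 hΨ2 hF hM hr hrR

/-! ## §3 The sections discharged by NE9 leaf-02's universal right inverse of `Q′_k` -/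

open B9Eq319QprimeTowerCentre (exists_QprimeTowerW_rightInverse) in
/-- **§3 SECTIONS-FREE**: §2 with the right inverses `S₁`∕`S₂` of `Q′_k(1)`∕`Q′_k(U)` and their bound `CS`
DISCHARGED by ne9-leaf-02's universal section (`exists_QprimeTowerW_rightInverse`: one `S` for every `φ`, `U`, `CS = (L^d)^{n+1}√(c₀·#T_m)`).
Background binders left: `Ũ ∈ G`, `U(b) ∈ U1`, `‖U(b) − 1‖ ≤ ε ≤ ε₁`, `U(b)* = U(b)⁻¹`. [folklore] -/
theorem kerCauchy_tower_of_small_bonds_unitary' {d : ℕ} (L : ℕ) [NeZero L] (m : Fin d → ℕ) [∀ i, NeZero (m i)] (n : ℕ) (hL : 1 ≤ L)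
    (hL2 : 2 ≤ L)
    {𝔸 : Type*} [NormedRing 𝔸] [NormedAlgebra ℂ 𝔸] [CompleteSpace 𝔸] [NormOneClass 𝔸] [StarRing 𝔸] [NormedStarGroup 𝔸] [StarModule ℂ 𝔸]
    [FiniteDimensional ℂ 𝔸]
    {W : Type*} [NormedAddCommGroup W] [InnerProductSpace ℂ W] [FiniteDimensional ℂ W] (φ : W ≃ₗ[ℂ] 𝔸) {Mφ Mφ' : ℝ} (hMφ : 0 ≤ Mφ)
    (hMφ' : 0 ≤ Mφ') (hφ : ∀ w, ‖φ w‖ ≤ Mφ * ‖w‖) (hφ' : ∀ X, ‖φ.symm X‖ ≤ Mφ' * ‖X‖)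
    (τ : 𝔸 →ₗ[ℂ] ℂ) {Cτ : ℝ} (hτ : ∀ X, ‖τ X‖ ≤ Cτ * ‖X‖) (hCτ : 0 ≤ Cτ)
    (hτφ : ∀ X Y : 𝔸, inner ℂ (φ.symm X) (φ.symm Y) = τ (star X * Y)) (htr : ∀ X Y : 𝔸, τ (X * Y) = τ (Y * X))
    {η : ℝ} (hη : η ≠ 0) [Fact (0 < (L : ℝ))] [Fact (0 < η)] {lev₀ : Bond d (towerP L m (n + 1)) → ℕ} {levB : Bond d m → ℕ}
    (lev₁ : Bond d (towerP L m (n + 1)) × Fin d → ℕ)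
    {G : Subgroup 𝔸ˣ} (hG : AvgClosed d L G) {α₀ : ℝ} (hα₀ : 0 < α₀) (hα3 : C0 d * α₀ ≤ 1 / 3) (hα4 : 4 * α₀ ≤ c2' d L)
    (hαL : 50 * (d + 1) * αT d L α₀ * (L : ℝ) ^ d ≤ 1 / 2) (hlev : ∀ b, n + 1 ≤ lev₀ b)
    {ρ : ℝ} (hρ0 : 0 < ρ) (hρ : Real.exp (4 * (800 * ((d : ℝ) + 1) ^ 2 * ((d : ℝ) + 4)) * α₀) * (1 + 8 * (131072 * ((d : ℝ) + 1) ^ 2) * ρ) ≤ 2)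
    (hρc : 2 * ρ ≤ c3 d L) {c₀ c₁ : ℝ} [Fact (0 < c₀)] [Fact (0 < c₁)] {a : ℝ} (ha : 0 < a)
    {X : Type*} [NormedAddCommGroup X] [NormedSpace ℂ X] [CompleteSpace X] :
    ∃ ε₁ : ℝ, 0 < ε₁ ∧ ∀ (U : Bond d (towerP L m (n + 1)) → 𝔸ˣ)
      (hUG : ∀ (x : B7Prop1Explicit.Site d) (κ : Fin d), perCfg (towerP L m (n + 1)) U x κ ∈ G)
      {ε : ℝ}, 0 ≤ ε → ε ≤ ε₁ →
      (∀ b, U b ∈ U1 𝔸) → (∀ b, ‖(U b : 𝔸) - 1‖ ≤ ε) → (∀ b, star (U b : 𝔸) = (((U b)⁻¹ : 𝔸ˣ) : 𝔸)) →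
      ∀ {Wq : Space115 (L : ℝ) η lev₀ lev₁ (nabla115 η U) → NegSize (L : ℝ) η lev₀ 3 𝔸} {C₄ a₃ : ℝ}, QuadAnalytic Wq C₄ a₃ → 0 ≤ C₄ → 0 < a₃ →
        AnalyticOnNhd ℂ Wq {Y | ‖Y‖ < a₃} →
      ∃ h52 : pdev (perCfg (towerP L m (n + 1)) U) < α₀ * (((L : ℝ) ^ (n + 1))⁻¹) ^ 2,
      ∃ hpos : ∀ x : BondL2K ℂ d (towerP L m (n + 1)) c₀ W, x ≠ 0 →
          0 < RCLike.re (inner ℂ x (laplaceAk L m n φ η U hL (fun _ => αT d L α₀) (fun _ => αT_le hL hα4)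
            (ulev_mem_U1_of_pdev L m (n + 1) U hL2 hG hUG hα₀ hα3 hα4 h52) (ulev_reg_of_pdev L m (n + 1) U hL2 hG hUG hα₀ hα3 hα4 h52) τ
            (c₀ := c₀) (c₁ := c₁) a x)),
      ∃ ε₄ εC Rb R' : ℝ, 0 < Rb ∧ 0 < R' ∧
        DifferentiableOn ℂ (chartHB (frakGLatticeCLM (lev₀ := lev₀) φ hpos (QkW_surjective L m n φ U hL _ _ _ _ fun _ => hαL) lev₁ (nabla115 η U))
            0 Wq 0 (fun A' => A' + solA (H1LatticeCLM (lev₀ := lev₀) (levB := levB) φ hpos (QkW_surjective L m n φ U hL _ _ _ _ fun _ => hαL) lev₁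
              (nabla115 η U)) 0 (Cck L m η (n + 1) U lev₀ lev₁ (nabla115 η U) levB) 0 εC A') ε₄
            (H1LatticeCLM (lev₀ := lev₀) (levB := levB) φ hpos (QkW_surjective L m n φ U hL _ _ _ _ fun _ => hαL) lev₁ (nabla115 η U)))
          (ball (0 : NegSize (L : ℝ) η levB 0 𝔸) Rb) ∧
        MapsTo (chartHB (frakGLatticeCLM (lev₀ := lev₀) φ hpos (QkW_surjective L m n φ U hL _ _ _ _ fun _ => hαL) lev₁ (nabla115 η U))
            0 Wq 0 (fun A' => A' + solA (H1LatticeCLM (lev₀ := lev₀) (levB := levB) φ hpos (QkW_surjective L m n φ U hL _ _ _ _ fun _ => hαL) lev₁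
              (nabla115 η U)) 0 (Cck L m η (n + 1) U lev₀ lev₁ (nabla115 η U) levB) 0 εC A') ε₄
            (H1LatticeCLM (lev₀ := lev₀) (levB := levB) φ hpos (QkW_surjective L m n φ U hL _ _ _ _ fun _ => hαL) lev₁ (nabla115 η U)))
          (ball (0 : NegSize (L : ℝ) η levB 0 𝔸) Rb) (ball (0 : Space115 (L : ℝ) η lev₀ lev₁ (nabla115 η U)) R') ∧
        chartHB (frakGLatticeCLM (lev₀ := lev₀) φ hpos (QkW_surjective L m n φ U hL _ _ _ _ fun _ => hαL) lev₁ (nabla115 η U))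
            0 Wq 0 (fun A' => A' + solA (H1LatticeCLM (lev₀ := lev₀) (levB := levB) φ hpos (QkW_surjective L m n φ U hL _ _ _ _ fun _ => hαL) lev₁
              (nabla115 η U)) 0 (Cck L m η (n + 1) U lev₀ lev₁ (nabla115 η U) levB) 0 εC A') ε₄
            (H1LatticeCLM (lev₀ := lev₀) (levB := levB) φ hpos (QkW_surjective L m n φ U hL _ _ _ _ fun _ => hαL) lev₁ (nabla115 η U)) 0 = 0 ∧
        ∀ (F' : Space115 (L : ℝ) η lev₀ lev₁ (nabla115 η U) → X) (M : ℝ),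
          DifferentiableOn ℂ F' (ball (0 : Space115 (L : ℝ) η lev₀ lev₁ (nabla115 η U)) R') →
          (∀ y ∈ ball (0 : Space115 (L : ℝ) η lev₀ lev₁ (nabla115 η U)) R', ‖F' y‖ ≤ M) →
          ∀ {r : ℝ}, 0 < r → r < Rb →
        (∀ N : ℕ, ‖iteratedFDeriv ℂ N (F' ∘ chartHB (frakGLatticeCLM (lev₀ := lev₀) φ hpos (QkW_surjective L m n φ U hL _ _ _ _ fun _ => hαL) lev₁
              (nabla115 η U))
            0 Wq 0 (fun A' => A' + solA (H1LatticeCLM (lev₀ := lev₀) (levB := levB) φ hpos (QkW_surjective L m n φ U hL _ _ _ _ fun _ => hαL) lev₁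
              (nabla115 η U)) 0 (Cck L m η (n + 1) U lev₀ lev₁ (nabla115 η U) levB) 0 εC A') ε₄
            (H1LatticeCLM (lev₀ := lev₀) (levB := levB) φ hpos (QkW_surjective L m n φ U hL _ _ _ _ fun _ => hαL) lev₁ (nabla115 η U))) 0‖ ≤
            M * ((N : ℝ) / r) ^ N) ∧
        (∀ (N : ℕ) (xs : Fin N → Bond d m) (b : Fin N → 𝔸),
          ‖kernelE (𝕜 := ℂ) N (F' ∘ chartHB (frakGLatticeCLM (lev₀ := lev₀) φ hpos (QkW_surjective L m n φ U hL _ _ _ _ fun _ => hαL) lev₁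
              (nabla115 η U))
            0 Wq 0 (fun A' => A' + solA (H1LatticeCLM (lev₀ := lev₀) (levB := levB) φ hpos (QkW_surjective L m n φ U hL _ _ _ _ fun _ => hαL) lev₁
              (nabla115 η U)) 0 (Cck L m η (n + 1) U lev₀ lev₁ (nabla115 η U) levB) 0 εC A') ε₄
            (H1LatticeCLM (lev₀ := lev₀) (levB := levB) φ hpos (QkW_surjective L m n φ U hL _ _ _ _ fun _ => hαL) lev₁ (nabla115 η U)) ∘
            (NegSup.continuousLinearEquiv ℂ (levWeight (L : ℝ) η levB 0) (V := 𝔸)).symm) 0 xs b‖ ≤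
            M * ((N : ℝ) / r) ^ N * ∏ k, ‖b k‖) ∧
        (∀ (δB B B' : Bond d m → 𝔸) (p q : Bond d m),
          ‖∑ x₁, ∑ x₂, kernelE (𝕜 := ℂ) 4 (F' ∘ chartHB (frakGLatticeCLM (lev₀ := lev₀) φ hpos (QkW_surjective L m n φ U hL _ _ _ _ fun _ => hαL)
              lev₁ (nabla115 η U))
            0 Wq 0 (fun A' => A' + solA (H1LatticeCLM (lev₀ := lev₀) (levB := levB) φ hpos (QkW_surjective L m n φ U hL _ _ _ _ fun _ => hαL) lev₁
              (nabla115 η U)) 0 (Cck L m η (n + 1) U lev₀ lev₁ (nabla115 η U) levB) 0 εC A') ε₄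
            (H1LatticeCLM (lev₀ := lev₀) (levB := levB) φ hpos (QkW_surjective L m n φ U hL _ _ _ _ fun _ => hαL) lev₁ (nabla115 η U)) ∘
            (NegSup.continuousLinearEquiv ℂ (levWeight (L : ℝ) η levB 0) (V := 𝔸)).symm) 0 ![p, x₁, x₂, q]
              ![δB p, B x₁, B x₂, B' q]‖ ≤
            M * ((4 : ℝ) / r) ^ 4 * (‖δB p‖ * ‖B‖ ^ 2 * ‖B' q‖)) := by
  obtain ⟨S, hS, -, hSn⟩ := exists_QprimeTowerW_rightInverse L m n (𝔸 := 𝔸) (W := W) (c₀ := c₀)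
  have hCS : (0 : ℝ) ≤ ((L : ℝ) ^ d) ^ (n + 1) * Real.sqrt (c₀ * Fintype.card (TSite d m)) := by positivity
  obtain ⟨ε₁, hε₁, H⟩ := kerCauchy_tower_of_small_bonds_unitary L m n hL hL2 φ (c₀ := c₀) (c₁ := c₁) (lev₀ := lev₀) (levB := levB)
    hMφ hMφ' hφ hφ' τ hτ hCτ hτφ htr hη lev₁ hG hα₀ hα3 hα4 hαL hlev hρ0 hρ hρc ha hCS (X := X)
  refine ⟨ε₁, hε₁, ?_⟩
  intro U hUG ε hε hεle hUb hUε hUstar Wq C₄ a₃ hW hC₄ ha₃ hWa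
  exact H U hUG S S hε hεle hUb hUε hUstar (hS φ _) (hS φ U) hSn hSn hW hC₄ ha₃ hWa

end Tower

end Summit.QuantumFields.BalabanUV.T4Continuum.NE9KerChartCauchyTower

end
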